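import Literature.Computability.AlgebraicComplexity.CoefficientExtraction
import Literature.Computability.AlgebraicComplexity.BurgisserBooleanParts
import Literature.Computability.AlgebraicComplexity.CircuitCoeffIdeal
import Literature.Computability.AlgebraicComplexity.VNPeEqVNP
import Mathlib.Algebra.BigOperators.Fin
import HarnessLib

/-!
# `VNP` is closed under taking coefficients (Valiant 1982; Bürgisser 2024 survey, Prop. 3.1) —
# PROVED in characteristic zero

Topic `Computability/AlgebraicComplexity`. Cell `val-lit`, row Bur2024-A (Bürgisser's 2024 survey
*Completeness classes in algebraic complexity theory*, arXiv:2406.06217), §3.1 "Robustness":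

> It is important that the class `VNP` is closed under taking coefficients [vali:82]. The precise
> meaning of this is as follows. Consider a sequence of polynomials `f_n ∈ 𝔽[X_n]` in the set of
> variables `X_n`. For each `n`, fix a monomial formed from a subset `Y_n` of `X_n` and let `h_n`
> denote the coefficient of this monomial in `f_n`. Thus `h_n` is a polynomial in the remaining
> variables `X_n ∖ Y_n`. We call `(h_n)` a coefficient sequence of `(f_n)`.
> **Proposition 3.1.** If `(f_n)` is `p`-definable, then any of its coefficient sequences is
> `p`-definable as well. (held text `paper:arxiv-2406.06217`, p0013 L17–L26.)

Rendering: the monomial variables `Y_n` are `Fin (a n)`, the remaining variables `τ n`, so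
`f_n ∈ F[Fin (a n) ⊕ τ n]`; the fixed monomial is `m n : Fin (a n) →₀ ℕ` and the coefficient is
`h_n = coeff (m n) (sumAlgEquiv F (Fin (a n)) (τ n) (f n)) ∈ F[τ n]` (Mathlib's `sumAlgEquiv`
views `F[Y ⊕ X]` as `(F[X])[Y]`); `p`-definable = the tree's `IsVNPFamily` (Bürgisser 2000
Def. 2.5 literally: a Boolean sum `Σ_{e ∈ {0,1}^u} g(X, e)` of a `VP` family).

* `CoeffVNP.boolSum_witness` — **coefficient extraction as ONE Boolean sum**: for
  `Γ ∈ F[Fin n ⊕ τ]` whose `Fin n`-degrees are `≤ 2^L − 1`,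
  `coeff m (sumAlgEquiv Γ) = Σ_{e ∈ {0,1}^{n·L}} W(X, e)` where
  `W = (∏_i T_i(e_i)) · Γ(dec(e_1), …, dec(e_n), X)` decodes the `L` bits `e_i` of each interpolation
  node `α_i = dec(e_i) ∈ {0, …, 2^L − 1}` by the linear form `Σ_l 2^l e_{il}` and reads the dual
  Vandermonde (Lagrange) coefficient `λ_{m_i, α_i}` off the multilinear table polynomial `T_i` —
  the tree's interpolation identity `coeff_sumAlgEquiv_eq_sum` (`CoefficientExtraction.lean`,
  `[x^m] Γ = Σ_{α ∈ {0..d}^n} (∏ λ_{m_i α_i}) Γ(α, y)`) re-indexed along the bijection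
  `{0,1}^{n·L} ≃ {0, …, 2^L−1}^n`;
* `CoeffVNP.complexity_witness_le`, `CoeffVNP.totalDegree_witness_le` — `W` has circuit size
  `≤ L(Γ) + n·(2^L (3L+3) + 2L + 2) + 1` and degree `≤ deg Γ + n·L`;
* `isVNPFamily_coeff_of_isVPFamily` — the coefficient sequences of a `VP` family are in `VNP`;
* `IsVNPFamily.boolSum` — Boolean sums of `VNP` families are in `VNP` (merge the two sums,
  `boolSum_boolSum` of `VNPeEqVNP.lean`, BCS Lemma (21.22));
* **`IsVNPFamily.coeff` — Proposition 3.1**: the coefficient sequences of a `VNP` family are in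
  `VNP` (the coefficient of a Boolean sum is the Boolean sum of the coefficients).

Scope: fields of CHARACTERISTIC ZERO (the interpolation nodes `0, 1, …, d` of
`CoefficientExtraction.lean` must be distinct); the printed proposition has no such restriction —
`-- TODO(general form): arbitrary fields (interpolate at d+1 distinct elements of an extension /
use the {0,1}-valued Kronecker substitution)`. Plumbing definitions (`CoeffVNP.*`) with bodies;
0 named facts. Honest framing: a 1982 closure property re-proved; nothing here bears on `VP ≠ VNP`,
which is NOT proved.

## References

* [Burgisser2024Completeness] P. Bürgisser, arXiv:2406.06217 (2024), §3.1, Prop. 3.1 (p0013 L17–L26).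
* [Valiant1982] L. G. Valiant, *Reducibility by algebraic projections*, L'Enseignement Math. 28
  (1982) 253–268, §3 ([vali:82] of the survey; cited through the survey).
* [Burgisser2000] P. Bürgisser, *Completeness and Reduction in Algebraic Complexity Theory*,
  Springer 2000, Def. 2.5 (`VNP`), §2.1 (interpolation).
* [BurgisserClausenShokrollahi1997] BCS, *Algebraic Complexity Theory*, Lemma (21.22)
  (nested Boolean sums).
-/

noncomputable section

open MvPolynomial

namespace Literature.Computability.AlgebraicComplexity

universe u v

namespace CoeffVNP

variable {F : Type u} [Field F] {τ : Type v} {n L : ℕ}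

/-! ### §1. The witness polynomial -/

/-- The Boolean variable number `(i, l)` (bit `l` of node `i`) among `n · L`. [cite: Burgisser2000, Def. 2.5] -/
def zv (n L : ℕ) (i : Fin n) (l : Fin L) : MvPolynomial (τ ⊕ Fin (n * L)) F :=
  X (Sum.inr (finProdFinEquiv (i, l)))

/-- The decoding linear form `Σ_l 2^l · e_{il}` of node `i`. [cite: Burgisser2000, §2.1 (interpolation nodes)] -/
def decPoly (n L : ℕ) (i : Fin n) : MvPolynomial (τ ⊕ Fin (n * L)) F :=
  ∑ l : Fin L, C ((2 : F) ^ (l : ℕ)) * zv n L i l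

/-- Bit `l` of `j < 2^L`, as a Boolean. [folklore] -/
def bitsOf (j : Fin (2 ^ L)) (l : Fin L) : Bool :=
  finTwoEquiv (finFunctionFinEquiv.symm j l)

/-- The indicator polynomial of "the bits `e_{i·}` spell `j`": `∏_l lit_{bit_l j}(e_{il})`.
[cite: Burgisser2000, Def. 2.5] -/
def indPoly (n L : ℕ) (i : Fin n) (j : Fin (2 ^ L)) : MvPolynomial (τ ⊕ Fin (n * L)) F :=
  ∏ l : Fin L, litPoly (bitsOf j l) (zv n L i l)

/-- The multilinear table polynomial `T_i = Σ_j λ_{m_i, j} · ind_j(e_{i·})` of the dual Vandermonde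
coefficients of row `m_i` on the nodes `0, …, 2^L − 1`. [cite: Burgisser2000, §2.1 (interpolation)] -/
def tablePoly (n L : ℕ) (m : Fin n →₀ ℕ) (i : Fin n) : MvPolynomial (τ ⊕ Fin (n * L)) F :=
  ∑ j : Fin (2 ^ L), C (vandermondeDual F (2 ^ L - 1) (m i) j) * indPoly n L i j

/-- `Γ(dec(e_1), …, dec(e_n), X)`: the monomial variables of `Γ` specialised to the decoding forms.
[cite: Burgisser2000, Rem. 2.7 (substitution)] -/
def substPoly (L : ℕ) (Γ : MvPolynomial (Fin n ⊕ τ) F) : MvPolynomial (τ ⊕ Fin (n * L)) F :=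
  aeval (Sum.elim (fun i => decPoly n L i) fun t => X (Sum.inl t)) Γ

/-- **The `VP` witness of the coefficient** `[x^m] Γ`: `W = (∏_i T_i) · Γ(dec e, X)`.
[cite: Burgisser2024Completeness, Prop. 3.1 (§3.1)] -/
def witness (L : ℕ) (Γ : MvPolynomial (Fin n ⊕ τ) F) (m : Fin n →₀ ℕ) :
    MvPolynomial (τ ⊕ Fin (n * L)) F :=
  (∏ i, tablePoly n L m i) * substPoly L Γ

/-- Decoding a Boolean point: node `i` is `Σ_l 2^l e_{il} < 2^L`. [folklore] -/
def dec (e : Fin (n * L) → Bool) (i : Fin n) : Fin (2 ^ L) :=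
  finFunctionFinEquiv fun l => finTwoEquiv.symm (e (finProdFinEquiv (i, l)))

/-- Encoding a tuple of nodes as a Boolean point. [folklore] -/
def enc (α : Fin n → Fin (2 ^ L)) (j : Fin (n * L)) : Bool :=
  finTwoEquiv (finFunctionFinEquiv.symm (α (finProdFinEquiv.symm j).1) (finProdFinEquiv.symm j).2)

/-- `{0,1}^{n·L} ≃ {0, …, 2^L − 1}^n` by binary decoding. [folklore] -/
def decEquiv (n L : ℕ) : (Fin (n * L) → Bool) ≃ (Fin n → Fin (2 ^ L)) where
  toFun := dec
  invFun := enc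
  left_inv e := by
    funext j
    simp only [enc, dec, Equiv.symm_apply_apply, Equiv.apply_symm_apply, Prod.mk.eta]
  right_inv α := by
    funext i
    simp only [enc, dec, Equiv.symm_apply_apply, Equiv.apply_symm_apply]

/-! ### §2. Values at Boolean points -/

/-- The Boolean specialisation `X_t ↦ X_t`, `e_j ↦ [e_j] ∈ {0,1}` of Valiant's Boolean sum
(`boolSum g = Σ_e bspec e g`). [cite: Burgisser2000, Def. 2.5] -/
def bspec {u : ℕ} (e : Fin u → Bool) : MvPolynomial (τ ⊕ Fin u) F →ₐ[F] MvPolynomial τ F :=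
  aeval (Sum.elim X fun j => if e j then 1 else 0)

/-- `boolSum` is the sum of the Boolean specialisations (definitional). [cite: Burgisser2000, Def. 2.5] -/
theorem boolSum_eq_sum_bspec {u : ℕ} (g : MvPolynomial (τ ⊕ Fin u) F) :
    boolSum g = ∑ e : Fin u → Bool, bspec e g := rfl

/-- `bspec e (C a) = C a`. [folklore] -/
@[simp] private theorem bspec_C {u : ℕ} (e : Fin u → Bool) (a : F) :
    bspec (τ := τ) e (C a) = C a := by
  simp [bspec]

/-- `bspec e (X (inl t)) = X t`. [folklore] -/
@[simp] private theorem bspec_X_inl {u : ℕ} (e : Fin u → Bool) (t : τ) :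
    bspec (F := F) e (X (Sum.inl t)) = X t := by
  simp [bspec]

/-- `bspec e (e_{il}) = [e_{il}]`. [folklore] -/
private theorem bspec_zv (e : Fin (n * L) → Bool) (i : Fin n) (l : Fin L) :
    bspec (F := F) (τ := τ) e (zv n L i l) = if e (finProdFinEquiv (i, l)) then 1 else 0 := by
  simp [bspec, zv]

/-- A literal of a bit variable evaluates to the indicator of agreement. [folklore] -/
private theorem bspec_litPoly_zv (e : Fin (n * L) → Bool) (b : Bool) (i : Fin n) (l : Fin L) :
    bspec (F := F) (τ := τ) e (litPoly b (zv n L i l)) =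
      if b = e (finProdFinEquiv (i, l)) then 1 else 0 := by
  cases b <;> cases h : e (finProdFinEquiv (i, l)) <;> simp [litPoly, map_sub, bspec_zv, h]

/-- `dec e i = j` iff the bits `e_{i·}` spell `j`. [folklore] -/
private theorem dec_eq_iff (e : Fin (n * L) → Bool) (i : Fin n) (j : Fin (2 ^ L)) :
    dec e i = j ↔ ∀ l, bitsOf j l = e (finProdFinEquiv (i, l)) := by
  rw [dec, Equiv.apply_eq_iff_eq_symm_apply, funext_iff]
  refine forall_congr' fun l => ?_
  rw [bitsOf, Equiv.symm_apply_eq]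
  exact eq_comm

/-- The indicator polynomial evaluates to `[dec e i = j]`. [folklore] -/
private theorem bspec_indPoly (e : Fin (n * L) → Bool) (i : Fin n) (j : Fin (2 ^ L)) :
    bspec (F := F) (τ := τ) e (indPoly n L i j) = if dec e i = j then 1 else 0 := by
  classical
  simp only [indPoly, map_prod, bspec_litPoly_zv, Finset.prod_boole, Finset.mem_univ,
    true_implies, dec_eq_iff]

/-- The table polynomial evaluates to the table entry at the decoded node:
`T_i([e]) = λ_{m_i, dec e i}`. [cite: Burgisser2000, §2.1 (interpolation)] -/
theorem bspec_tablePoly (e : Fin (n * L) → Bool) (m : Fin n →₀ ℕ) (i : Fin n) :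
    bspec (F := F) (τ := τ) e (tablePoly n L m i) =
      C (vandermondeDual F (2 ^ L - 1) (m i) (dec e i)) := by
  classical
  simp only [tablePoly, map_sum, map_mul, bspec_C, bspec_indPoly, mul_boole,
    Finset.sum_ite_eq, Finset.mem_univ, if_true]

/-- The value of a decoded node as a field element is the value of the decoding form:
`Σ_l 2^l [e_{il}] = dec e i`. [folklore] -/
private theorem bspec_decPoly [CharZero F] (e : Fin (n * L) → Bool) (i : Fin n) :
    bspec (F := F) (τ := τ) e (decPoly n L i) = C (((dec e i : ℕ) : F)) := by
  have hbit : ∀ b : Bool, ((finTwoEquiv.symm b : Fin 2) : ℕ) = if b then 1 else 0 := by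
    intro b; cases b <;> rfl
  simp only [decPoly, map_sum, map_mul, bspec_C, bspec_zv, dec, finFunctionFinEquiv_apply,
    Nat.cast_sum, Nat.cast_mul, Nat.cast_pow, Nat.cast_ofNat, hbit, map_sum]
  refine Finset.sum_congr rfl fun l _ => ?_
  split_ifs <;> simp [mul_comm]

/-- `Γ(dec e, X)`: the substituted polynomial at a Boolean point is `Γ` at the decoded integer
nodes. [cite: Burgisser2000, Rem. 2.7] -/
theorem bspec_substPoly [CharZero F] (e : Fin (n * L) → Bool) (Γ : MvPolynomial (Fin n ⊕ τ) F) :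
    bspec e (substPoly L Γ) = aeval (Sum.elim (fun i => C (((dec e i : ℕ) : F))) X) Γ := by
  rw [substPoly, ← AlgHom.comp_apply, comp_aeval]
  have hfun : (fun v => bspec e (Sum.elim (fun i => decPoly n L i) (fun t => X (Sum.inl t)) v)) =
      Sum.elim (fun i => C (((dec e i : ℕ) : F))) (X : τ → MvPolynomial τ F) := by
    funext v
    rcases v with i | t
    · exact bspec_decPoly e i
    · exact bspec_X_inl e t
  rw [hfun]

/-- The witness at a Boolean point is the `dec e`-term of the interpolation formula.
[cite: Burgisser2024Completeness, Prop. 3.1 (§3.1)] -/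
theorem bspec_witness [CharZero F] (e : Fin (n * L) → Bool) (Γ : MvPolynomial (Fin n ⊕ τ) F)
    (m : Fin n →₀ ℕ) :
    bspec e (witness L Γ m) = C (∏ i, vandermondeDual F (2 ^ L - 1) (m i) (dec e i)) *
      aeval (Sum.elim (fun i => C (((dec e i : ℕ) : F))) X) Γ := by
  rw [witness, map_mul, map_prod, bspec_substPoly, map_prod]
  simp only [bspec_tablePoly]

/-! ### §3. Coefficient extraction as one Boolean sum -/

/-- **`[x^m] Γ = Σ_{e ∈ {0,1}^{n·L}} W(X, e)`** — the interpolation identity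
`coeff_sumAlgEquiv_eq_sum` re-indexed by binary decoding of the nodes `{0, …, 2^L − 1}`
(`Fin n`-degrees of `Γ` at most `2^L − 1`; characteristic zero).
[cite: Burgisser2024Completeness, Prop. 3.1 (§3.1)] [cite: Burgisser2000, §2.1 (interpolation)] -/
theorem boolSum_witness [CharZero F] (Γ : MvPolynomial (Fin n ⊕ τ) F) (m : Fin n →₀ ℕ)
    (hd : ∀ i, degreeOf i (sumAlgEquiv F (Fin n) τ Γ) ≤ 2 ^ L - 1) :
    boolSum (witness L Γ m) = coeff m (sumAlgEquiv F (Fin n) τ Γ) := by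
  classical
  have hpow : 2 ^ L - 1 + 1 = 2 ^ L := Nat.sub_add_cancel Nat.one_le_two_pow
  rw [coeff_sumAlgEquiv_eq_sum Γ hd m, boolSum_eq_sum_bspec]
  refine Fintype.sum_equiv ((decEquiv n L).trans
    (Equiv.arrowCongr (Equiv.refl (Fin n)) (finCongr hpow.symm))) _ _ fun e => ?_
  rw [bspec_witness]
  simp [decEquiv, Equiv.arrowCongr]

/-! ### §4. Size and degree of the witness -/

/-- `L(e_{il}) = 0`. [folklore] -/
private theorem complexity_zv (i : Fin n) (l : Fin L) :
    complexity (zv (F := F) (τ := τ) n L i l) = 0 := by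
  rw [zv, complexity_X_holds]

section Size

/-- `L(Σ_l 2^l e_{il}) ≤ 2L`. [cite: Burgisser2000, §2.1] -/
private theorem complexity_decPoly_le (i : Fin n) :
    complexity (decPoly (F := F) (τ := τ) n L i) ≤ 2 * L := by
  unfold decPoly
  refine (complexity_finset_sum_le _ _).trans ?_
  have h : ∀ l : Fin L,
      complexity (C ((2 : F) ^ (l : ℕ)) * zv (F := F) (τ := τ) n L i l) ≤ 1 := fun l => by
    rw [← smul_eq_C_mul]
    refine (complexity_smul_le_holds _ _).trans ?_
    rw [complexity_zv]
  calc ∑ l : Fin L, complexity (C ((2 : F) ^ (l : ℕ)) * zv (F := F) (τ := τ) n L i l) +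
        (Finset.univ : Finset (Fin L)).card
      ≤ ∑ _l : Fin L, 1 + (Finset.univ : Finset (Fin L)).card := by gcongr with l; exact h l
    _ = 2 * L := by simp; ring

/-- `L(ind_j(e_{i·})) ≤ 3L`. [folklore] -/
private theorem complexity_indPoly_le (i : Fin n) (j : Fin (2 ^ L)) :
    complexity (indPoly (F := F) (τ := τ) n L i j) ≤ 3 * L := by
  unfold indPoly
  refine (complexity_finset_prod_le _ _).trans ?_
  calc ∑ l : Fin L, complexity (litPoly (bitsOf j l) (zv (F := F) (τ := τ) n L i l)) +
        (Finset.univ : Finset (Fin L)).card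
      ≤ ∑ _l : Fin L, 2 + (Finset.univ : Finset (Fin L)).card := by
        gcongr with l
        exact (complexity_litPoly_le _ _).trans (by rw [complexity_zv])
    _ = 3 * L := by simp; ring

/-- `L(T_i) ≤ 2^L (3L + 2)`. [folklore] -/
private theorem complexity_tablePoly_le (m : Fin n →₀ ℕ) (i : Fin n) :
    complexity (tablePoly (F := F) (τ := τ) n L m i) ≤ 2 ^ L * (3 * L + 2) := by
  unfold tablePoly
  refine (complexity_finset_sum_le _ _).trans ?_
  have h : ∀ j : Fin (2 ^ L), complexity (C (vandermondeDual F (2 ^ L - 1) (m i) j) *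
      indPoly (F := F) (τ := τ) n L i j) ≤ 3 * L + 1 := fun j => by
    rw [← smul_eq_C_mul]
    exact (complexity_smul_le_holds _ _).trans (Nat.add_le_add_right (complexity_indPoly_le i j) 1)
  calc ∑ j : Fin (2 ^ L), complexity (C (vandermondeDual F (2 ^ L - 1) (m i) j) *
          indPoly (F := F) (τ := τ) n L i j) + (Finset.univ : Finset (Fin (2 ^ L))).card
      ≤ ∑ _j : Fin (2 ^ L), (3 * L + 1) + (Finset.univ : Finset (Fin (2 ^ L))).card := by
        gcongr with j; exact h j
    _ = 2 ^ L * (3 * L + 2) := by simp; ring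

/-- `L(Γ(dec e, X)) ≤ L(Γ) + 2nL` (substitution, Bürgisser Rem. 2.7). [cite: Burgisser2000, Rem. 2.7] -/
theorem complexity_substPoly_le [Fintype τ] (Γ : MvPolynomial (Fin n ⊕ τ) F) :
    complexity (substPoly (τ := τ) L Γ) ≤ complexity Γ + n * (2 * L) := by
  unfold substPoly
  refine (complexity_aeval_le Γ _).trans (Nat.add_le_add_left ?_ _)
  rw [Fintype.sum_sum_type]
  simp only [Sum.elim_inl, Sum.elim_inr]
  have hX : ∑ t : τ, complexity (X (Sum.inl t) : MvPolynomial (τ ⊕ Fin (n * L)) F) = 0 :=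
    Finset.sum_eq_zero fun t _ => complexity_X_holds _
  rw [hX, add_zero]
  calc ∑ i : Fin n, complexity (decPoly (F := F) (τ := τ) n L i) ≤ ∑ _i : Fin n, 2 * L := by
        gcongr with i; exact complexity_decPoly_le i
    _ = n * (2 * L) := by simp

/-- **Size of the witness**: `L(W) ≤ L(Γ) + n (2^L (3L+2) + 1) + 2nL + 1`.
[cite: Burgisser2024Completeness, Prop. 3.1 (§3.1)] -/
theorem complexity_witness_le [Fintype τ] (Γ : MvPolynomial (Fin n ⊕ τ) F) (m : Fin n →₀ ℕ) :
    complexity (witness L Γ m) ≤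
      complexity Γ + (n * (2 ^ L * (3 * L + 2) + 1) + n * (2 * L) + 1) := by
  unfold witness
  refine (complexity_mul_le_holds _ _).trans ?_
  have h1 : complexity (∏ i, tablePoly (F := F) (τ := τ) n L m i) ≤
      n * (2 ^ L * (3 * L + 2) + 1) := by
    refine (complexity_finset_prod_le _ _).trans ?_
    calc ∑ i : Fin n, complexity (tablePoly (F := F) (τ := τ) n L m i) + (Finset.univ : Finset (Fin n)).card
        ≤ ∑ _i : Fin n, 2 ^ L * (3 * L + 2) + (Finset.univ : Finset (Fin n)).card := by
          gcongr with i; exact complexity_tablePoly_le m i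
      _ = n * (2 ^ L * (3 * L + 2) + 1) := by simp; ring
  have h2 := complexity_substPoly_le (τ := τ) (L := L) Γ
  omega

end Size

section Degree

/-- `deg e_{il} ≤ 1`. [folklore] -/
private theorem totalDegree_zv_le (i : Fin n) (l : Fin L) :
    (zv (F := F) (τ := τ) n L i l).totalDegree ≤ 1 :=
  mvPolynomial_totalDegree_X_le_one _

/-- The decoding form has degree `≤ 1`. [folklore] -/
private theorem totalDegree_decPoly_le (i : Fin n) :
    (decPoly (F := F) (τ := τ) n L i).totalDegree ≤ 1 := by
  unfold decPoly
  refine totalDegree_finsetSum_le fun l _ => (totalDegree_mul _ _).trans ?_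
  rw [totalDegree_C, zero_add]
  exact totalDegree_zv_le i l

/-- `deg ind_j ≤ L`. [folklore] -/
private theorem totalDegree_indPoly_le (i : Fin n) (j : Fin (2 ^ L)) :
    (indPoly (F := F) (τ := τ) n L i j).totalDegree ≤ L := by
  unfold indPoly
  refine (totalDegree_finsetProd _ _).trans ?_
  calc ∑ l : Fin L, (litPoly (bitsOf j l) (zv (F := F) (τ := τ) n L i l)).totalDegree
      ≤ ∑ _l : Fin L, 1 := by
        gcongr with l
        exact (totalDegree_litPoly_le _ _).trans (totalDegree_zv_le i l)
    _ = L := by simp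

/-- `deg T_i ≤ L`. [folklore] -/
private theorem totalDegree_tablePoly_le (m : Fin n →₀ ℕ) (i : Fin n) :
    (tablePoly (F := F) (τ := τ) n L m i).totalDegree ≤ L := by
  unfold tablePoly
  refine totalDegree_finsetSum_le fun j _ => (totalDegree_mul _ _).trans ?_
  rw [totalDegree_C, zero_add]
  exact totalDegree_indPoly_le i j

/-- `deg Γ(dec e, X) ≤ deg Γ` (substitution of forms of degree `≤ 1`). [folklore] -/
private theorem totalDegree_substPoly_le (Γ : MvPolynomial (Fin n ⊕ τ) F) :
    (substPoly (τ := τ) L Γ).totalDegree ≤ Γ.totalDegree := by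
  unfold substPoly
  refine totalDegree_aeval_le_of_le_one _ (fun v => ?_) Γ
  rcases v with i | t
  · exact totalDegree_decPoly_le i
  · exact mvPolynomial_totalDegree_X_le_one _

/-- **Degree of the witness**: `deg W ≤ nL + deg Γ`. [cite: Burgisser2024Completeness, Prop. 3.1 (§3.1)] -/
theorem totalDegree_witness_le (Γ : MvPolynomial (Fin n ⊕ τ) F) (m : Fin n →₀ ℕ) :
    (witness L Γ m).totalDegree ≤ n * L + Γ.totalDegree := by
  unfold witness
  refine (totalDegree_mul _ _).trans (add_le_add ?_ (totalDegree_substPoly_le Γ))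
  refine (totalDegree_finsetProd _ _).trans ?_
  calc ∑ i : Fin n, (tablePoly (F := F) (τ := τ) n L m i).totalDegree ≤ ∑ _i : Fin n, L := by
        gcongr with i; exact totalDegree_tablePoly_le m i
    _ = n * L := by simp

end Degree

/-! ### §5. Separating variables and Boolean specialisation commute -/

/-- The `Fin n`-degrees of `Γ` viewed in `(F[X])[Y]` are at most the total degree of `Γ`.
[folklore] -/
private theorem degreeOf_sumAlgEquiv_le (Γ : MvPolynomial (Fin n ⊕ τ) F) (i : Fin n) :
    degreeOf i (sumAlgEquiv F (Fin n) τ Γ) ≤ Γ.totalDegree := by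
  classical
  rw [degreeOf_le_iff]
  intro s hs
  obtain ⟨β, hβ⟩ := MvPolynomial.ne_zero_iff.mp (mem_support_iff.mp hs)
  rw [coeff_coeff_sumAlgEquiv] at hβ
  refine le_trans ?_ (le_totalDegree (mem_support_iff.mpr hβ))
  rw [Finsupp.sum_sumElim]
  refine le_trans ?_ (Nat.le_add_right _ _)
  by_cases hi : i ∈ s.support
  · exact Finset.single_le_sum (f := fun j => s j) (fun j _ => Nat.zero_le _) hi
  · rw [Finsupp.notMem_support_iff.mp hi]
    exact Nat.zero_le _

/-- **The coefficient of a Boolean specialisation is the Boolean specialisation of the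
coefficient**: separating the `Fin n`-variables commutes with specialising the Boolean variables
(which live on the coefficient side). [cite: Burgisser2000, Def. 2.5] -/
theorem sumAlgEquiv_bspec {u : ℕ} (e : Fin u → Bool) (p : MvPolynomial ((Fin n ⊕ τ) ⊕ Fin u) F) :
    sumAlgEquiv F (Fin n) τ (bspec e p) =
      MvPolynomial.map (bspec (τ := τ) e : MvPolynomial (τ ⊕ Fin u) F →ₐ[F] MvPolynomial τ F)
        (sumAlgEquiv F (Fin n) (τ ⊕ Fin u) (rename (Equiv.sumAssoc (Fin n) τ (Fin u)) p)) := by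
  have key : (sumAlgEquiv F (Fin n) τ).toAlgHom.comp (bspec (τ := Fin n ⊕ τ) e) =
      (mapAlgHom (bspec (τ := τ) e)).comp
        ((sumAlgEquiv F (Fin n) (τ ⊕ Fin u)).toAlgHom.comp
          (rename (Equiv.sumAssoc (Fin n) τ (Fin u)))) := by
    refine MvPolynomial.algHom_ext fun v => ?_
    rcases v with (i | t) | j
    · simp [bspec, sumAlgEquiv_X_inl]
    · simp [bspec, sumAlgEquiv_X_inr]
    · by_cases h : e j
      · simp [bspec, h, sumAlgEquiv_X_inr]
      · simp [bspec, h, sumAlgEquiv_X_inr]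
  have := DFunLike.congr_fun key p
  simpa using this

/-- Hence the coefficient of a Boolean sum is the Boolean sum of the coefficients.
[cite: Burgisser2024Completeness, Prop. 3.1 (§3.1, proof idea)] -/
theorem coeff_sumAlgEquiv_boolSum {u : ℕ} (p : MvPolynomial ((Fin n ⊕ τ) ⊕ Fin u) F)
    (m : Fin n →₀ ℕ) :
    coeff m (sumAlgEquiv F (Fin n) τ (boolSum p)) =
      boolSum (coeff m (sumAlgEquiv F (Fin n) (τ ⊕ Fin u)
        (rename (Equiv.sumAssoc (Fin n) τ (Fin u)) p))) := by
  rw [boolSum_eq_sum_bspec, boolSum_eq_sum_bspec, map_sum, coeff_sum]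
  refine Finset.sum_congr rfl fun e _ => ?_
  rw [sumAlgEquiv_bspec, coeff_map]
  rfl

end CoeffVNP

/-! ### §6. Family statements: Proposition 3.1 -/

section Family

open CoeffVNP

variable {F : Type u} [Field F]

/-- `2^{size d} ≤ 2d + 1`. [folklore] -/
private theorem two_pow_size_le (d : ℕ) : 2 ^ Nat.size d ≤ 2 * d + 1 := by
  rcases Nat.eq_zero_or_pos d with rfl | hd
  · simp
  · have h1 : 0 < Nat.size d := Nat.size_pos.mpr hd
    have h2 : 2 ^ (Nat.size d - 1) ≤ d := Nat.lt_size.mp (by omega)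
    calc 2 ^ Nat.size d = 2 * 2 ^ (Nat.size d - 1) := by
          rw [← pow_succ']; congr 1; omega
      _ ≤ 2 * d + 1 := by omega

/-- `size d ≤ d + 1`. [folklore] -/
private theorem size_le_succ (d : ℕ) : Nat.size d ≤ d + 1 :=
  Nat.size_le.mpr ((Nat.lt_two_pow_self).trans (Nat.pow_lt_pow_right (by norm_num) (by omega)))

/-- **Boolean sums of `VNP` families are in `VNP`** (merge the two Boolean sums: BCS Lemma (21.22),
the tree's `boolSum_boolSum`). [cite: BurgisserClausenShokrollahi1997, Lemma (21.22)] -/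
theorem IsVNPFamily.boolSum {ρ : ℕ → Type v} [∀ k, Fintype (ρ k)] [∀ k, DecidableEq (ρ k)]
    {v : ℕ → ℕ} {G : ∀ k, MvPolynomial (ρ k ⊕ Fin (v k)) F} (hG : IsVNPFamily G) :
    IsVNPFamily fun k => boolSum (G k) := by
  obtain ⟨⟨hvars, hdeg⟩, u, g, ⟨⟨gvars, gdeg⟩, gcx⟩, hGg⟩ := hG
  refine ⟨⟨hvars.mono fun k => ?_, hdeg.mono fun k => totalDegree_boolSum_le _⟩,
    fun k => v k + u k,
    fun k => rename ((Equiv.sumAssoc (ρ k) (Fin (v k)) (Fin (u k))).trans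
      (Equiv.sumCongr (Equiv.refl (ρ k)) finSumFinEquiv)) (g k),
    ⟨⟨gvars.mono fun k => le_of_eq ?_, gdeg.mono fun k => totalDegree_rename_le _ _⟩,
      gcx.mono fun k => complexity_rename_le_holds' _ _⟩,
    fun k => by beta_reduce; rw [hGg k, boolSum_boolSum]⟩
  · simp [Fintype.card_sum]
  · exact Fintype.card_congr ((Equiv.sumAssoc (ρ k) (Fin (v k)) (Fin (u k))).trans
      (Equiv.sumCongr (Equiv.refl (ρ k)) finSumFinEquiv)).symm

variable [CharZero F]

/-- **The coefficient sequences of a `VP` family are in `VNP`** (the case `(f_n) ∈ VP` of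
Prop. 3.1; characteristic zero): `h_k = [x^{m_k}] g_k = Σ_{e ∈ {0,1}^{a_k L_k}} W_k(X, e)` with the
`VP` witness `W_k` of `CoeffVNP.boolSum_witness`, `L_k = size (deg g_k)` bits per node.
[cite: Burgisser2024Completeness, Prop. 3.1 (§3.1)] [cite: Valiant1982, §3] -/
theorem isVNPFamily_coeff_of_isVPFamily {a : ℕ → ℕ} {τ : ℕ → Type v} [∀ k, Fintype (τ k)]
    [∀ k, DecidableEq (τ k)] {g : ∀ k, MvPolynomial (Fin (a k) ⊕ τ k) F} (hg : IsVPFamily g)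
    (m : ∀ k, Fin (a k) →₀ ℕ) :
    IsVNPFamily fun k => coeff (m k) (sumAlgEquiv F (Fin (a k)) (τ k) (g k)) := by
  obtain ⟨⟨hvars, hdeg⟩, hcx⟩ := hg
  set L : ℕ → ℕ := fun k => Nat.size (g k).totalDegree with hL
  have ha : IsPBounded a := hvars.mono fun k => by simp [Fintype.card_sum]
  have hτ : IsPBounded fun k => Fintype.card (τ k) := hvars.mono fun k => by simp [Fintype.card_sum]
  have hLb : IsPBounded L := (IsPBounded.add_holds hdeg (IsPBounded.const 1)).mono fun k =>
    size_le_succ _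
  have hPb : IsPBounded fun k => 2 ^ L k :=
    (IsPBounded.add_holds (IsPBounded.mul_holds (IsPBounded.const 2) hdeg) (IsPBounded.const 1)).mono
      fun k => two_pow_size_le _
  have hd : ∀ k i, degreeOf i (sumAlgEquiv F (Fin (a k)) (τ k) (g k)) ≤ 2 ^ L k - 1 :=
    fun k i => (degreeOf_sumAlgEquiv_le _ _).trans (Nat.le_sub_one_of_lt (Nat.lt_size_self _))
  refine ⟨⟨hτ, hdeg.mono fun k => totalDegree_coeff_sumAlgEquiv_le _ _⟩,
    fun k => a k * L k, fun k => witness (L k) (g k) (m k), ⟨⟨?_, ?_⟩, ?_⟩,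
    fun k => (boolSum_witness (g k) (m k) (hd k)).symm⟩
  · -- variables of the witness: `#τ_k + a_k L_k`
    exact (IsPBounded.add_holds hτ (IsPBounded.mul_holds ha hLb)).mono fun k => by
      simp [Fintype.card_sum]
  · -- degree of the witness
    exact (IsPBounded.add_holds (IsPBounded.mul_holds ha hLb) hdeg).mono fun k =>
      totalDegree_witness_le _ _
  · -- size of the witness
    refine (IsPBounded.add_holds hcx (IsPBounded.add_holds (IsPBounded.add_holds
      (IsPBounded.mul_holds ha (IsPBounded.add_holds (IsPBounded.mul_holds hPb
        (IsPBounded.add_holds (IsPBounded.mul_holds (IsPBounded.const 3) hLb) (IsPBounded.const 2)))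
        (IsPBounded.const 1)))
      (IsPBounded.mul_holds ha (IsPBounded.mul_holds (IsPBounded.const 2) hLb)))
      (IsPBounded.const 1))).mono fun k => ?_
    exact complexity_witness_le _ _

/-- **Bürgisser 2024, Prop. 3.1 (Valiant 1982): `VNP` is closed under taking coefficients**
(characteristic zero). If `(f_k)` is `p`-definable, `f_k ∈ F[Fin (a k) ⊕ τ k]`, and `m_k` is a
monomial in the variables `Fin (a k)`, then the coefficient sequence
`h_k = [Y^{m_k}] f_k ∈ F[τ k]` is `p`-definable. Proof: `f_k = Σ_e g_k(X, e)` with `g ∈ VP`, so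
`h_k = Σ_e [Y^{m_k}] g_k(·, e)` (`coeff_sumAlgEquiv_boolSum`), the coefficient family of the `VP`
family `g` is in `VNP` (`isVNPFamily_coeff_of_isVPFamily`), and Boolean sums of `VNP` families are
in `VNP` (`IsVNPFamily.boolSum`).
[cite: Burgisser2024Completeness, Prop. 3.1 (§3.1, p0013 L17–L26)] [cite: Valiant1982, §3] -/
theorem IsVNPFamily.coeff {a : ℕ → ℕ} {τ : ℕ → Type v} [∀ k, Fintype (τ k)]
    [∀ k, DecidableEq (τ k)] {f : ∀ k, MvPolynomial (Fin (a k) ⊕ τ k) F} (hf : IsVNPFamily f)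
    (m : ∀ k, Fin (a k) →₀ ℕ) :
    IsVNPFamily fun k => coeff (m k) (sumAlgEquiv F (Fin (a k)) (τ k) (f k)) := by
  obtain ⟨-, u, g, ⟨⟨gvars, gdeg⟩, gcx⟩, hfg⟩ := hf
  -- regroup the variables of `g_k` as `Fin (a k) ⊕ (τ k ⊕ Fin (u k))`
  let g' : ∀ k, MvPolynomial (Fin (a k) ⊕ (τ k ⊕ Fin (u k))) F :=
    fun k => rename (Equiv.sumAssoc (Fin (a k)) (τ k) (Fin (u k))) (g k)
  have hg' : IsVPFamily g' :=
    ⟨⟨gvars.mono fun k => le_of_eq (Fintype.card_congr (Equiv.sumAssoc _ _ _).symm),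
      gdeg.mono fun k => totalDegree_rename_le _ _⟩,
      gcx.mono fun k => complexity_rename_le_holds' _ _⟩
  have h1 : IsVNPFamily fun k =>
      MvPolynomial.coeff (m k) (sumAlgEquiv F (Fin (a k)) (τ k ⊕ Fin (u k)) (g' k)) :=
    isVNPFamily_coeff_of_isVPFamily hg' m
  have h2 := IsVNPFamily.boolSum h1
  have key : (fun k => MvPolynomial.coeff (m k) (sumAlgEquiv F (Fin (a k)) (τ k) (f k))) =
      fun k => _root_.Literature.Computability.AlgebraicComplexity.boolSum (MvPolynomial.coeff (m k)
        (sumAlgEquiv F (Fin (a k)) (τ k ⊕ Fin (u k)) (g' k))) := by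
    funext k
    rw [hfg k]
    exact coeff_sumAlgEquiv_boolSum (g k) (m k)
  rw [key]
  exact h2

end Family

end Literature.Computability.AlgebraicComplexity

end
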